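import Mathlib
import HarnessLib
import Summits.NavierStokesRegularity.NavierStokesRegularity.Theorems.PoloidalWindowDoorLrcModEntireTwistingTHRidgeLaw
import Summits.NavierStokesRegularity.NavierStokesRegularity.Theorems.PoloidalWindowDoorLrcModEntireRidgeFrame

/-!
# Item `LrcModEntire` (stmt-NavierStokesRegularity-20428), registry twist_split v7 — WIRING the (TH) ridge law into the ridge lever (memo `Cruxes/LrcModEntire/T2B-g14.md` §11):
# along a hot arc of a (TH) thread plane, `κ(s) = −σD²v₂[ν,ν]` and `β(s) = σD²v₂[e_z,e_z]` are CONSTANT (the hypotheses `hκ`, `hβ` of `…RidgeTwist.quasiconvexOn_sq_nuZ_of_class`)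

LEAD of item 20428 ns-poloidal-K2-p3 g14 (`--supports stmt-NavierStokesRegularity-20428 --as helper`).  Combines `…TwistingTHRidgeLaw` (p707183: `∂₀²v₂ + ∂₁²v₂` and — through
`plane_wave_identity` — `∂₂²v₂` take one value on the hot set of a (TH) thread plane with a `C³` slope function, `μ(−1,0) ≠ 1`) with `…RidgeFrame` (p707993: on a critical arc with
horizontal unit normal `ν = a e₀ + b e₁`, tangent speed `c ≠ 0`, `D²f[ν,ν] = D²f[e₀,e₀] + D²f[e₁,e₁]`), and the bookkeeping `D²f(y)[u,w] = ∂_u(∂_w f)(y)` for `f = σ·v₂(−1,·)`.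

* `fderiv_fderiv_eq_coord` — `fderiv ℝ (fderiv ℝ f) y u w = fderiv ℝ (fun x => fderiv ℝ f x w) y u` (`f ∈ C²`).
* `kappa_beta_const_on_hotArc` — class clauses + poloidal + hot-spot normalisation + (TH) slope function near the thread plane (`…TwistingTHSlopeFunction`) with `μ(−1,0) ≠ 1` + an arc
  `γ` of HOT points of `P₀` on an open parameter set `I`, moving frame `(a, b)` with `a² + b² = 1`, velocity `γ′(s) = c(s)·τ(s)`, `c(s) ≠ 0` ⇒ for `s, s′ ∈ I`:
  `D²f(γ s)[ν s, ν s] = D²f(γ s′)[ν s′, ν s′]` and `D²f(γ s)[e_z,e_z] = D²f(γ s′)[e_z,e_z]`, `f = σ·v₂(−1,·)`.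

WHAT THIS IS NOT: not a claim about Navier–Stokes regularity — plumbing for `stub_T2b` (bears_on LADDER-NS N0, item 20428 / crux 19708; both OPEN, ⟨27893⟩ OPEN).
-/

noncomputable section

-- the summit and its single sub-problem share the name (CONVENTIONS §1), as in every Theorems file
set_option linter.dupNamespace false

namespace Summit.NavierStokesRegularity.NavierStokesRegularity.Theorems.PoloidalWindowDoorLrcModEntireRidgeWiring

open MeasureTheory Set Function Filter Topology
open scoped RealInnerProductSpace InnerProductSpace Laplacian ContDiff
open Literature.Analysis Literature.Analysis.FluidPDE Literature.Analysis.UnboundedOperators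
open Summit.NavierStokesRegularity.NavierStokesRegularity.Theorems
open Summit.NavierStokesRegularity.NavierStokesRegularity.Theorems.PoloidalWindowDoorLrcModEntireTwistingTHRidgeLaw
open Summit.NavierStokesRegularity.NavierStokesRegularity.Theorems.PoloidalWindowDoorLrcModEntireRidgeFrame
open Summit.NavierStokesRegularity.NavierStokesRegularity.Theorems.PoloidalWindowDoorLrcModEntireTwistingTHHotPointPins
open Summit.NavierStokesRegularity.NavierStokesRegularity.Theorems.PoloidalWindowDoorPoloidalWindowRigidityTimeHeightShearLinearSlice
open Summit.NavierStokesRegularity.NavierStokesRegularity.Theorems.PoloidalWindowDoorPoloidalWindowRigidityConstantShearSlice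
open Summit.NavierStokesRegularity.NavierStokesRegularity.Theorems.PoloidalWindowDoorPoloidalWindowRigidityClebsch
open Summit.NavierStokesRegularity.NavierStokesRegularity.Theorems.PoloidalWindowDoorPoloidalWindowRigiditySlopeFunctionPressure

/-- `D²f(y)[u,w] = ∂_u(∂_w f)(y)` for `f ∈ C²`. -/
theorem fderiv_fderiv_eq_coord {E : Type*} [NormedAddCommGroup E] [NormedSpace ℝ E] {f : E → ℝ} (hf : ContDiff ℝ 2 f) (y u w : E) :
    fderiv ℝ (fderiv ℝ f) y u w = fderiv ℝ (fun x => fderiv ℝ f x w) y u := by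
  have hd : Differentiable ℝ (fderiv ℝ f) := (hf.fderiv_right (m := 1) (by norm_num)).differentiable one_ne_zero
  rw [fderiv_clm_apply (hd y) (differentiableAt_const w)]
  simp

variable {C : ℝ} {v : ℝ → EuclideanSpace ℝ (Fin 3) → EuclideanSpace ℝ (Fin 3)}

/-- **`κ` and `β` are constant along a hot arc of a (TH) thread plane.**  See the module docstring. -/
theorem kappa_beta_const_on_hotArc (hrate : HasTypeITimeDecay C v)
    (hcont : ContinuousOn (uncurry v) (Iio (0 : ℝ) ×ˢ univ))
    (hmild : ∀ s t : ℝ, s < t → t < 0 → ∀ x, v t x = heatExtension (v s) (t - s) x - oseenDuhamel 1 s v v t x)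
    (hdiv : ∀ t < 0, VectorCalculus.IsDivFree (v t))
    (hpol : ∀ s < 0, ∀ y, ⟪curl (v s) y, EuclideanSpace.single 2 1⟫_ℝ = 0)
    {μ : ℝ → ℝ → ℝ} (hμ : ContDiff ℝ 3 (uncurry μ))
    (hslope : ∀ y : EuclideanSpace ℝ (Fin 3), y 2 = 0 →
      ∀ᶠ z in 𝓝 (((-1 : ℝ), y) : ℝ × EuclideanSpace ℝ (Fin 3)), ∀ b : Fin 3, b ≠ 2 →
        fderiv ℝ (v z.1) z.2 (EuclideanSpace.single 2 1) b = μ z.1 (z.2 2) * fderiv ℝ (v z.1) z.2 (EuclideanSpace.single b 1) 2)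
    (hμ1 : μ (-1) 0 ≠ 1)
    (hne : v (-1) 0 2 ≠ 0) (hhot : ∀ t < 0, ∀ x, Real.sqrt (-t) * |v t x 2| ≤ |v (-1) 0 2|)
    (σ : ℝ) {I : Set ℝ} (hI : IsOpen I) {γ : ℝ → EuclideanSpace ℝ (Fin 3)} {a b c : ℝ → ℝ}
    (hab : ∀ s ∈ I, a s ^ 2 + b s ^ 2 = 1) (hc : ∀ s ∈ I, c s ≠ 0)
    (hγ : ∀ s ∈ I, HasDerivAt γ (c s • (-b s • EuclideanSpace.single 0 (1 : ℝ) + a s • EuclideanSpace.single 1 (1 : ℝ))) s)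
    (hγhot : ∀ s ∈ I, γ s 2 = 0 ∧ v (-1) (γ s) 2 = v (-1) 0 2) {s s' : ℝ} (hs : s ∈ I) (hs' : s' ∈ I) :
    fderiv ℝ (fderiv ℝ (fun y => σ * v (-1) y 2)) (γ s) (a s • EuclideanSpace.single 0 1 + b s • EuclideanSpace.single 1 1)
        (a s • EuclideanSpace.single 0 1 + b s • EuclideanSpace.single 1 1) =
      fderiv ℝ (fderiv ℝ (fun y => σ * v (-1) y 2)) (γ s') (a s' • EuclideanSpace.single 0 1 + b s' • EuclideanSpace.single 1 1)
        (a s' • EuclideanSpace.single 0 1 + b s' • EuclideanSpace.single 1 1) ∧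
    fderiv ℝ (fderiv ℝ (fun y => σ * v (-1) y 2)) (γ s) (EuclideanSpace.single 2 1) (EuclideanSpace.single 2 1) =
      fderiv ℝ (fderiv ℝ (fun y => σ * v (-1) y 2)) (γ s') (EuclideanSpace.single 2 1) (EuclideanSpace.single 2 1) := by
  have h1 : (-1 : ℝ) < 0 := by norm_num
  set θ : EuclideanSpace ℝ (Fin 3) → ℝ := fun y => v (-1) y 2 with hθdef
  set f : EuclideanSpace ℝ (Fin 3) → ℝ := fun y => σ * v (-1) y 2 with hfdef
  have hθ : ContDiff ℝ 2 θ := (PoloidalWindowDoorPoloidalWindowRigiditySlopeFunctionPressure.contDiff_vert_slice hrate hcont hmild hdiv h1).of_le (by norm_cast)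
  have hfθ : f = σ • θ := by funext y; simp [hfdef, hθdef, smul_eq_mul]
  have hf : ContDiff ℝ 2 f := by rw [hfθ]; exact hθ.const_smul σ
  -- second derivatives of `f` are `σ` times those of `θ`
  have hD2 : ∀ y u w, fderiv ℝ (fderiv ℝ f) y u w = σ * fderiv ℝ (fun x => fderiv ℝ θ x w) y u := by
    intro y u w
    rw [fderiv_fderiv_eq_coord hf]
    have e1 : (fun x => fderiv ℝ f x w) = fun x => σ * fderiv ℝ θ x w := by
      funext x
      rw [hfθ, fderiv_const_smul ((hθ.differentiable (by norm_num)) x) σ]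
      simp [smul_eq_mul]
    rw [e1]
    have hdw : DifferentiableAt ℝ (fun x => fderiv ℝ θ x w) y :=
      (((hθ.fderiv_right (m := 1) (by norm_num)).differentiable one_ne_zero).clm_apply (differentiable_const w)) y
    rw [show (fun x => σ * fderiv ℝ θ x w) = σ • (fun x => fderiv ℝ θ x w) by funext x; simp [smul_eq_mul], fderiv_const_smul hdw σ]
    simp [smul_eq_mul]
  -- the hot arc is critical for `f`
  have hcritθ : ∀ t ∈ I, fderiv ℝ θ (γ t) = 0 := by
    intro t ht
    ext h
    have := gradPin_of_hotPoint hrate hcont hmild hdiv hhot (hγhot t ht).2 h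
    have hd : DifferentiableAt ℝ (v (-1)) (γ t) := ((PoloidalWindowDoorPoloidalWindowRigidityClebsch.contDiff_slice hrate hcont hmild h1).differentiable (by simp)) _
    have hc2 := ((EuclideanSpace.proj (𝕜 := ℝ) (2 : Fin 3)).hasFDerivAt.comp (γ t) hd.hasFDerivAt).fderiv
    rw [hθdef, show (fun y => v (-1) y 2) = (EuclideanSpace.proj (𝕜 := ℝ) (2 : Fin 3)) ∘ v (-1) from rfl, hc2]
    simpa using this
  have hcritf : ∀ t ∈ I, fderiv ℝ f (γ t) = 0 := by
    intro t ht
    rw [hfθ, fderiv_const_smul ((hθ.differentiable (by norm_num)) (γ t)) σ, hcritθ t ht, smul_zero]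
  have hcrit_ev : ∀ t ∈ I, ∀ᶠ t' in 𝓝 t, fderiv ℝ f (γ t') = 0 := fun t ht =>
    Filter.Eventually.mono (hI.mem_nhds ht) fun t' ht' => hcritf t' ht'
  -- (TH) ridge law: horizontal Laplacian and `∂₂²` of `θ` take one value on the hot set
  have hslope0 : ∀ w : EuclideanSpace ℝ (Fin 3), w 2 = 0 → ∀ b' : Fin 3, b' ≠ 2 →
      fderiv ℝ (v (-1)) w (EuclideanSpace.single 2 (1 : ℝ)) b' = μ (-1) 0 * fderiv ℝ (v (-1)) w (EuclideanSpace.single b' (1 : ℝ)) 2 := by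
    intro w hw b' hb'
    have h := (hslope w hw).self_of_nhds b' hb'
    rw [hw] at h; exact h
  have hu : ContDiff ℝ 2 (v (-1)) := (PoloidalWindowDoorPoloidalWindowRigidityClebsch.contDiff_slice hrate hcont hmild h1).of_le (by norm_cast)
  have hH : ∀ t ∈ I, fderiv ℝ (fun w => fderiv ℝ θ w (EuclideanSpace.single 0 (1 : ℝ))) (γ t) (EuclideanSpace.single 0 (1 : ℝ)) +
      fderiv ℝ (fun w => fderiv ℝ θ w (EuclideanSpace.single 1 (1 : ℝ))) (γ t) (EuclideanSpace.single 1 (1 : ℝ)) =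
      fderiv ℝ (fun w => fderiv ℝ θ w (EuclideanSpace.single 0 (1 : ℝ))) (γ s') (EuclideanSpace.single 0 (1 : ℝ)) +
      fderiv ℝ (fun w => fderiv ℝ θ w (EuclideanSpace.single 1 (1 : ℝ))) (γ s') (EuclideanSpace.single 1 (1 : ℝ)) := fun t ht =>
    horizLaplacian_two_eq_of_hotPoints hrate hcont hmild hdiv hpol hμ hslope hμ1 hne hhot (hγhot t ht).1 (hγhot s' hs').1 (hγhot t ht).2 (hγhot s' hs').2
  have hW : ∀ t ∈ I, fderiv ℝ (fun w => fderiv ℝ θ w (EuclideanSpace.single 2 (1 : ℝ))) (γ t) (EuclideanSpace.single 2 (1 : ℝ)) =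
      -μ (-1) 0 * (fderiv ℝ (fun w => fderiv ℝ θ w (EuclideanSpace.single 0 (1 : ℝ))) (γ t) (EuclideanSpace.single 0 (1 : ℝ)) +
        fderiv ℝ (fun w => fderiv ℝ θ w (EuclideanSpace.single 1 (1 : ℝ))) (γ t) (EuclideanSpace.single 1 (1 : ℝ))) := fun t ht =>
    plane_wave_identity hu (fun x => div_coord (hdiv (-1) h1) x) hslope0 (hγhot t ht).1
  -- frame algebra at `s` and `s'`
  have hframe : ∀ t ∈ I, fderiv ℝ (fderiv ℝ f) (γ t) (a t • EuclideanSpace.single 0 1 + b t • EuclideanSpace.single 1 1)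
      (a t • EuclideanSpace.single 0 1 + b t • EuclideanSpace.single 1 1) =
      fderiv ℝ (fderiv ℝ f) (γ t) (EuclideanSpace.single 0 1) (EuclideanSpace.single 0 1) +
        fderiv ℝ (fderiv ℝ f) (γ t) (EuclideanSpace.single 1 1) (EuclideanSpace.single 1 1) := fun t ht =>
    fderiv_fderiv_normal_eq_horizLaplacian hf (hab t ht) rfl rfl (hc t ht) (hγ t ht) (hcrit_ev t ht)
  refine ⟨?_, ?_⟩
  · rw [hframe s hs, hframe s' hs', hD2, hD2, hD2, hD2, ← mul_add, ← mul_add, hH s hs]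
  · rw [hD2, hD2, hW s hs, hW s' hs', hH s hs]

end Summit.NavierStokesRegularity.NavierStokesRegularity.Theorems.PoloidalWindowDoorLrcModEntireRidgeWiring
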